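import Summits.QuantumFields.YangMills.Theorems.ConvexGribovBodyCovarianceBoundDefsB
import Summits.QuantumFields.YangMills.Theorems.ConvexGribovBodyCovarianceBoundStubSupMeasurable
import Summits.QuantumFields.YangMills.Theorems.ConvexGribovBodyCovarianceBoundStubModeReduction
import Summits.QuantumFields.YangMills.Theorems.ConvexGribovBodyCovarianceBoundStubProjSplit

/-!
# Stub `stub_supLeCov` for the crux `CovarianceBound` (stmt-QuantumFields-8780), line `Sketch`

Route `QuantumFields/YangMills/ConvexGribovBody`, crux
`Summit.QuantumFields.YangMills.Theses.ConvexGribovBody.CovarianceBound`, skeleton line `Sketch`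
(v7, minimal moment form). This file proves the registered classical glue stub `stub_supLeCov`
over the line's vocabulary (`…CovarianceBoundDefs.lean`, `…CovarianceBoundDefsB.lean`): for every
configuration `U`, momentum `p` and direction `j`, the sups over the absolute Coulomb minimisers
of `‖Ĉ_j(p)‖²_F`, `‖P_𝔤 Ĉ_j(p)‖²_F` and `‖Ĉ_j(p) − P_𝔤 Ĉ_j(p)‖²_F` are at most `L³ · sup_h cov(U,h,p)`,
`L = 2S+1`. Pointwise in a minimiser `h`:
`‖P_𝔤 Ĉ‖², ‖Ĉ − P_𝔤 Ĉ‖² ≤ ‖Ĉ_j‖² ≤ ‖Ĉ_j‖² + ‖Ŝ_j‖² ≤ Σ_j (‖Ĉ_j‖² + ‖Ŝ_j‖²) = L³ cov(U,h,p) ≤ L³ sup_h cov`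
(Pythagoras for `P_𝔤`, `ProjSplit`; the mode identity `ModeReduction.modeCov_eq_cos_sin`;
`le_ciSup` with the a-priori bound `SupMeasurable.modeCov_le`), then `ciSup_le` over the minimiser
subtype, nonempty by `SupMeasurable.exists_isCoulMin`.

Helper lemmas live in the sub-namespace `SupLeCov`. No named facts are used.
-/

set_option autoImplicit false

noncomputable section

namespace Summit.QuantumFields.YangMills.Cruxes.CovarianceBound.SupportWindow

open scoped BigOperators Matrix ComplexConjugate
open MeasureTheory
open Literature.MathematicalPhysics.QuantumFieldTheory

/-! ### Helper lemmas (sub-namespace `SupLeCov`) -/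

namespace SupLeCov

variable {G : Type} [Group G] [TopologicalSpace G]
variable (r : LatticeRep G) (S : ℕ) (p : Fin 3 → ZMod (2 * S + 1)) (j : Fin 3)
  (U : GaugeConfig 4 (2 * S + 1) G) (h : Site 4 (2 * S + 1) → G)

/-- `‖Ĉ_j(p)‖²_F ≤ L³ · cov(U,h,p)`: drop the sine mode and the other two directions in
`L³ cov = Σ_j (‖Ĉ_j‖²_F + ‖Ŝ_j‖²_F)`. [folklore] -/
theorem froSq_cosMode_le_mul_modeCov :
    froSq (cosMode r S p j U h) ≤ (2 * S + 1 : ℝ) ^ 3 * modeCov r S U h p := by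
  have hL : (0 : ℝ) < (2 * S + 1 : ℝ) ^ 3 := by positivity
  rw [ModeReduction.modeCov_eq_cos_sin, mul_div_cancel₀ _ hL.ne']
  exact (le_add_of_nonneg_right (SupMeasurable.froSq_nonneg _)).trans
    (Finset.single_le_sum (f := fun j' => froSq (cosMode r S p j' U h) +
      froSq (sinMode r S p j' U h))
      (fun _ _ => add_nonneg (SupMeasurable.froSq_nonneg _) (SupMeasurable.froSq_nonneg _))
      (Finset.mem_univ j))

/-- `cov(U,h,p) ≤ sup_{h'} cov(U,h',p)` for an absolute Coulomb minimiser `h` (the range is bounded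
by `3 N L³`). [folklore] -/
theorem modeCov_le_supCov (hh : IsCoulMin r S U h) : modeCov r S U h p ≤ supCov r S p U :=
  le_ciSup (f := fun h' : {h' : Site 4 (2 * S + 1) → G // IsCoulMin r S U h'} =>
      modeCov r S U h'.1 p)
    ⟨3 * r.N * (2 * S + 1 : ℝ) ^ 3, by
      rintro _ ⟨h', rfl⟩
      exact SupMeasurable.modeCov_le r S U h'.1 p⟩ ⟨h, hh⟩

/-- If `g h ≤ ‖Ĉ_j(p)‖²_F` at every absolute Coulomb minimiser `h`, then
`sup_h g h ≤ L³ · sup_h cov(U,h,p)` (the minimiser set is nonempty). [folklore] -/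
theorem ciSup_le_mul_supCov [IsTopologicalGroup G] [CompactSpace G]
    (g : (Site 4 (2 * S + 1) → G) → ℝ)
    (hg : ∀ h, IsCoulMin r S U h → g h ≤ froSq (cosMode r S p j U h)) :
    (⨆ h' : {h' : Site 4 (2 * S + 1) → G // IsCoulMin r S U h'}, g h'.1) ≤
      (2 * S + 1 : ℝ) ^ 3 * supCov r S p U := by
  obtain ⟨h₀, hh₀⟩ := SupMeasurable.exists_isCoulMin r S U
  haveI : Nonempty {h' : Site 4 (2 * S + 1) → G // IsCoulMin r S U h'} := ⟨⟨h₀, hh₀⟩⟩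
  refine ciSup_le fun h' => (hg h'.1 h'.2).trans ?_
  exact (froSq_cosMode_le_mul_modeCov r S p j U h'.1).trans
    (mul_le_mul_of_nonneg_left (modeCov_le_supCov r S p U h'.1 h'.2) (by positivity))

end SupLeCov

/-! ### The stub -/

open SupLeCov in
/-- **Stub `stub_supLeCov` (classical glue).** For every configuration `U`, momentum `p` and
direction `j`: `sup_h ‖Ĉ_j(p)‖²_F`, `sup_h ‖P_𝔤 Ĉ_j(p)‖²_F` and `sup_h ‖Ĉ_j(p) − P_𝔤 Ĉ_j(p)‖²_F`
(sups over the absolute Coulomb minimisers) are at most `L³ · sup_h cov(U,h,p)`, `L = 2S+1`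
(`‖P_𝔤 Ĉ‖², ‖Ĉ − P_𝔤 Ĉ‖² ≤ ‖Ĉ_j‖² ≤ ‖Ĉ_j‖² + ‖Ŝ_j‖² ≤ Σ_j (‖Ĉ_j‖² + ‖Ŝ_j‖²) = L³ cov`,
`le_ciSup` / `ciSup_le` over the nonempty minimiser subtype). [folklore] -/
theorem stub_supLeCov :
    ∀ (G : Type) [Group G] [TopologicalSpace G] [IsTopologicalGroup G] [CompactSpace G]
      [MeasurableSpace G] [BorelSpace G] (r : LatticeRep G) (S : ℕ) (p : Fin 3 → ZMod (2 * S + 1))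
      (j : Fin 3) (U : GaugeConfig 4 (2 * S + 1) G),
      supCosSq r S p j U ≤ (2 * S + 1 : ℝ) ^ 3 * supCov r S p U ∧
      supLieCosSq r S p j U ≤ (2 * S + 1 : ℝ) ^ 3 * supCov r S p U ∧
      supPerpCosSq r S p j U ≤ (2 * S + 1 : ℝ) ^ 3 * supCov r S p U := by
  intro G _ _ _ _ _ _ r S p j U
  refine ⟨?_, ?_, ?_⟩
  · exact ciSup_le_mul_supCov r S p j U (fun h => froSq (cosMode r S p j U h))
      fun h _ => le_rfl
  · exact ciSup_le_mul_supCov r S p j U (fun h => froSq (lieCosMode r S p j U h))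
      fun h _ => ProjSplit.froSq_lieProj_le r _
  · exact ciSup_le_mul_supCov r S p j U (fun h => froSq (perpCosMode r S p j U h))
      fun h _ => ProjSplit.froSq_sub_lieProj_le r _

end Summit.QuantumFields.YangMills.Cruxes.CovarianceBound.SupportWindow

end
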